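import Mathlib
import Summits.ValiantsHypothesis.ValiantsHypothesis.Theorems.LacunarySymmetroidMatrixDescartesDetMultiplicityJordanChainKit

/-!
# `MatrixDescartes` (stmt-ValiantsHypothesis-18050) — THE FIRST-ORDER MULTIPLICITY LAW: `mult_r det M = corank M(r)` unless a
# Jordan chain of length two exists (any square real polynomial matrix); kernel-form criterion for symmetric pencils

HONEST FRAMING.  Cell `pub-symmetroid`, seat `val-sym-mdr-p2` (gen 16); helper file `--supports` the crux
`Theses.LacunarySymmetroid.MatrixDescartes`, NO closure claim.  A general linear-algebra tool (any square matrix of real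
polynomials, any format): the CONVERSE half of gen 15's «corank ≤ multiplicity» (`Multiplicity.X_sub_C_pow_dvd_det_of_rank`).
Nothing here bears on the crux in its window, on `stub_twoSided`, on `DoorA26`/`DoorA34`, registers, or `VP ≠ VNP`.

THEOREM (first-order multiplicity law).  `M` an `n × n` matrix over `ℝ[X]`, `r : ℝ`, `A = M(r)`, `B = M′(r)` (entrywise
derivative, evaluated), `s = card n − rank A` (corank).  A (left) JORDAN CHAIN OF LENGTH TWO at `r` is a pair `(v, w)` with
`v ≠ 0`, `v A = 0`, `w A + v B = 0` (row vectors; equivalently `u(X) = v + (X − r) w` is a root function of order ≥ 2: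
`u(X) M(X) ≡ 0 mod (X − r)²`).  Then
* (`X_sub_C_pow_succ_dvd_det_of_chain`) a chain forces `(X − r)^{s+1} ∣ det M` — one more than the corank;
* (`rootMultiplicity_det_eq_corank_of_no_chain`) if NO chain exists then `det M ≠ 0` and `mult_r det M = s` EXACTLY.
So `mult_r det M = corank M(r)` iff all Jordan chains at `r` have length one (all partial multiplicities equal 1; `r` is a
SEMISIMPLE eigenvalue of the matrix polynomial) — the standard local theory of matrix polynomials (Gohberg–Lancaster–Rodman,
Matrix Polynomials, 1982, Ch. 1 and 7: the multiplicity of `r` as a zero of `det M` is the sum of the partial multiplicities,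
the corank is their number), proved here WITHOUT Smith forms: complete a basis of the left kernel of `A` to a basis (rows of an
invertible `P`), pull one factor `X − r` out of each kernel row of `P·M` (`P·M = D·N`, `det D = (X − r)^s`), and read
`N(r)` = «kernel rows of `P·B`, other rows of `P·A`»; `N(r)` is singular iff a chain exists.
SYMMETRIC FORM (`rootMultiplicity_det_eq_corank_of_kernelForm`): if `A` is symmetric and every non-zero kernel vector is
NON-NEUTRAL for the kernel form, `vᵀ B v ≠ 0`, then no chain exists (a chain gives `vᵀBv = −vᵀA w = 0`), so
`mult_r det M = dim ker M(r)`.  PENCIL FORM (`rootMultiplicity_det_pencil_eq_corank`): for a lacunary pencil `F(X) = ∑ₖ X^{dₖ} Sₖ`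
with real symmetric letters, `vᵀF′(r)v = P_v′(r)` is the derivative of the Rayleigh polynomial `P_v = ∑ₖ (vᵀSₖv) X^{dₖ}`, so:
if every non-zero kernel vector of `F(r)` has `r` as a SIMPLE root of its Rayleigh polynomial («`r` is an eigenvalue of
definite or mixed but non-neutral type»), then `r` is a root of `det F` of multiplicity EXACTLY `dim ker F(r)`.  This is the
multiplicity half of the exact zone count on the intrinsic hyperbolic sector (`…DefiniteMomentsZonesExact`). [folklore];
axioms standard; no definitions.
-/

-- layout Summits/ValiantsHypothesis/ValiantsHypothesis forces the duplicated namespace component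
set_option linter.dupNamespace false

namespace Summit.ValiantsHypothesis.ValiantsHypothesis.Theorems.LacunarySymmetroidMatrixDescartes

open Polynomial Matrix Finset
open scoped BigOperators

namespace Multiplicity

variable {n : Type} [Fintype n] [DecidableEq n]

/-! ## §4 The first-order multiplicity law -/

/-- **A Jordan chain of length two forces one more factor.**  If `v ≠ 0`, `v·M(r) = 0` and `w·M(r) + v·M′(r) = 0`, then
`(X − r)^{corank M(r) + 1}` divides `det M`. [folklore] -/
theorem X_sub_C_pow_succ_dvd_det_of_chain (M : Matrix n n ℝ[X]) (r : ℝ) (v w : n → ℝ) (hv0 : v ≠ 0)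
    (hv : v ᵥ* M.map (eval r) = 0)
    (hw : w ᵥ* M.map (eval r) + v ᵥ* (M.map derivative).map (eval r) = 0) :
    (X - C r) ^ (Fintype.card n - (M.map (eval r)).rank + 1) ∣ M.det := by
  classical
  set A := M.map (eval r) with hA
  set B := (M.map derivative).map (eval r) with hB
  obtain ⟨P, u, hP, hu, hrank⟩ := exists_adapted_rows A
  obtain ⟨N, hdet, hN⟩ := exists_row_extraction M r P u hu
  have hsing : (N.map (eval r)).det = 0 := by
    rw [hN]
    exact det_piecewise_eq_zero_of_chain A B P u hP hu hrank v w hv0 hv hw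
  have hdvdN : (X - C r) ∣ N.det := by
    rw [dvd_iff_isRoot, IsRoot]
    have h := RingHom.map_det (evalRingHom r) N
    rw [coe_evalRingHom] at h
    rw [h]
    exact hsing
  have hcard : Fintype.card n - A.rank = u.card := by omega
  rw [hcard]
  have h1 : (X - C r) ^ (u.card + 1) ∣ C P.det * M.det := by
    rw [hdet, pow_succ]
    exact mul_dvd_mul_left _ hdvdN
  have hunit : IsUnit (C P.det) := isUnit_C.2 ((Matrix.isUnit_iff_isUnit_det P).1 hP)
  exact (hunit.dvd_mul_left).1 h1

/-- **No chain ⇒ exact multiplicity.**  If `M(r)` admits no Jordan chain of length two (every `v` with `v·M(r) = 0` and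
`w·M(r) + v·M′(r) = 0` for some `w` is zero), then `det M ≠ 0` and `mult_r det M = corank M(r)` exactly. [folklore] -/
theorem rootMultiplicity_det_eq_corank_of_no_chain (M : Matrix n n ℝ[X]) (r : ℝ)
    (hno : ∀ v w : n → ℝ, v ᵥ* M.map (eval r) = 0 →
      w ᵥ* M.map (eval r) + v ᵥ* (M.map derivative).map (eval r) = 0 → v = 0) :
    M.det ≠ 0 ∧ M.det.rootMultiplicity r = Fintype.card n - (M.map (eval r)).rank := by
  classical
  set A := M.map (eval r) with hA
  set B := (M.map derivative).map (eval r) with hB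
  obtain ⟨P, u, hP, hu, hrank⟩ := exists_adapted_rows A
  obtain ⟨N, hdet, hN⟩ := exists_row_extraction M r P u hu
  have hreg : (N.map (eval r)).det ≠ 0 := by
    rw [hN]
    exact det_piecewise_ne_zero_of_no_chain A B P u hP hu hrank hno
  have hNr : ¬ N.det.IsRoot r := by
    rw [IsRoot]
    have h := RingHom.map_det (evalRingHom r) N
    rw [coe_evalRingHom] at h
    rw [h]
    exact hreg
  have hN0 : N.det ≠ 0 := fun h => hNr (by rw [h, IsRoot, eval_zero])
  have hPdet : P.det ≠ 0 := ((Matrix.isUnit_iff_isUnit_det P).1 hP).ne_zero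
  have hC : C P.det ≠ 0 := fun h => hPdet (C_eq_zero.1 h)
  have hpow : ((X - C r) ^ u.card : ℝ[X]) ≠ 0 := pow_ne_zero _ (X_sub_C_ne_zero r)
  have hrhs : (X - C r) ^ u.card * N.det ≠ 0 := mul_ne_zero hpow hN0
  have hM : M.det ≠ 0 := by
    intro h
    rw [h, mul_zero] at hdet
    exact hrhs hdet.symm
  refine ⟨hM, ?_⟩
  have hmul := congrArg (fun p : ℝ[X] => p.rootMultiplicity r) hdet
  rw [rootMultiplicity_mul (mul_ne_zero hC hM), rootMultiplicity_mul hrhs, rootMultiplicity_C, zero_add,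
    rootMultiplicity_X_sub_C_pow, rootMultiplicity_eq_zero hNr, add_zero] at hmul
  rw [hmul]
  omega

/-! ## §5 Symmetric matrices: the kernel-form criterion -/

/-- **Kernel-form criterion.**  If `M(r)` is symmetric and every non-zero kernel vector `v` (`M(r) v = 0`) is NON-NEUTRAL,
`vᵀ M′(r) v ≠ 0`, then no Jordan chain of length two exists, so `det M ≠ 0` and `mult_r det M = dim ker M(r)`. [folklore] -/
theorem rootMultiplicity_det_eq_corank_of_kernelForm (M : Matrix n n ℝ[X]) (r : ℝ) (hsymm : (M.map (eval r)).IsSymm)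
    (hdef : ∀ v : n → ℝ, M.map (eval r) *ᵥ v = 0 → v ≠ 0 →
      v ⬝ᵥ ((M.map derivative).map (eval r) *ᵥ v) ≠ 0) :
    M.det ≠ 0 ∧ M.det.rootMultiplicity r = Fintype.card n - (M.map (eval r)).rank := by
  refine rootMultiplicity_det_eq_corank_of_no_chain M r fun v w hv hw => ?_
  set A := M.map (eval r) with hA
  set B := (M.map derivative).map (eval r) with hB
  have hvA : A *ᵥ v = 0 := by rw [← hsymm.eq, Matrix.mulVec_transpose]; exact hv
  by_contra hv0
  apply hdef v hvA hv0
  have h1 : v ᵥ* B = -(w ᵥ* A) := eq_neg_of_add_eq_zero_right hw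
  calc v ⬝ᵥ (B *ᵥ v) = (v ᵥ* B) ⬝ᵥ v := Matrix.dotProduct_mulVec v B v
    _ = -((w ᵥ* A) ⬝ᵥ v) := by rw [h1, neg_dotProduct]
    _ = -(w ⬝ᵥ (A *ᵥ v)) := by rw [Matrix.dotProduct_mulVec]
    _ = 0 := by rw [hvA, dotProduct_zero, neg_zero]

/-! ## §6 Lacunary pencils -/

section Pencil

variable {ι κ : Type} [Fintype ι] [DecidableEq ι] [Fintype κ]

omit [Fintype ι] [DecidableEq ι] in
/-- The pencil evaluated at `r`. [folklore] -/
theorem pencil_map_eval (d : κ → ℕ) (S : κ → Matrix ι ι ℝ) (r : ℝ) :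
    (∑ k, ((X : ℝ[X]) ^ d k) • (S k).map C).map (eval r) = ∑ k, r ^ d k • S k := by
  ext i j
  simp only [Matrix.map_apply, Matrix.sum_apply, Matrix.smul_apply, smul_eq_mul, eval_finsetSum, eval_mul, eval_pow,
    eval_X, eval_C]

omit [Fintype ι] [DecidableEq ι] in
/-- The derivative of the pencil evaluated at `r`: `F′(r) = ∑ₖ dₖ r^{dₖ−1} Sₖ`. [folklore] -/
theorem pencil_map_derivative_eval (d : κ → ℕ) (S : κ → Matrix ι ι ℝ) (r : ℝ) :
    ((∑ k, ((X : ℝ[X]) ^ d k) • (S k).map C).map derivative).map (eval r)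
      = ∑ k, ((d k : ℝ) * r ^ (d k - 1)) • S k := by
  ext i j
  simp only [Matrix.map_apply, Matrix.sum_apply, Matrix.smul_apply, smul_eq_mul, derivative_sum, eval_finsetSum]
  refine Finset.sum_congr rfl fun k _ => ?_
  rw [show (X : ℝ[X]) ^ d k * C (S k i j) = C (S k i j) * X ^ d k by ring, derivative_C_mul_X_pow, eval_mul, eval_C,
    eval_pow, eval_X]
  ring

omit [DecidableEq ι] in
/-- The kernel form is the derivative of the Rayleigh polynomial: `vᵀF′(r)v = P_v′(r)`. [folklore] -/
theorem form_derivative_eq_eval (d : κ → ℕ) (S : κ → Matrix ι ι ℝ) (r : ℝ) (v : ι → ℝ) :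
    v ⬝ᵥ ((∑ k, ((d k : ℝ) * r ^ (d k - 1)) • S k) *ᵥ v)
      = (derivative (∑ k, C (v ⬝ᵥ (S k *ᵥ v)) * (X : ℝ[X]) ^ d k)).eval r := by
  simp only [derivative_sum, derivative_C_mul_X_pow, eval_finsetSum, eval_mul, eval_C, eval_pow, eval_X,
    Matrix.sum_mulVec, dotProduct_sum]
  refine Finset.sum_congr rfl fun k _ => ?_
  rw [Matrix.smul_mulVec, dotProduct_smul, smul_eq_mul]
  ring

/-- **FIRST-ORDER MULTIPLICITY LAW FOR LACUNARY SYMMETRIC PENCILS.**  `F(X) = ∑ₖ X^{dₖ} Sₖ` with real symmetric letters,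
`r : ℝ`.  If every non-zero kernel vector `v` of `F(r)` has `r` as a SIMPLE root of its Rayleigh polynomial
`P_v = ∑ₖ (vᵀSₖv) X^{dₖ}` (`P_v′(r) ≠ 0`: the eigenvalue `r` has no neutral eigenvector), then `det F ≠ 0` and `r` is a
root of `det F` of multiplicity EXACTLY `dim ker F(r) = card ι − rank F(r)`. [folklore] -/
theorem rootMultiplicity_det_pencil_eq_corank (d : κ → ℕ) (S : κ → Matrix ι ι ℝ) (hS : ∀ k, (S k).IsSymm) (r : ℝ)
    (hdef : ∀ v : ι → ℝ, (∑ k, r ^ d k • S k) *ᵥ v = 0 → v ≠ 0 →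
      (derivative (∑ k, C (v ⬝ᵥ (S k *ᵥ v)) * (X : ℝ[X]) ^ d k)).eval r ≠ 0) :
    Matrix.det (∑ k, ((X : ℝ[X]) ^ d k) • (S k).map C) ≠ 0 ∧
      (Matrix.det (∑ k, ((X : ℝ[X]) ^ d k) • (S k).map C)).rootMultiplicity r
        = Fintype.card ι - (∑ k, r ^ d k • S k).rank := by
  have h := rootMultiplicity_det_eq_corank_of_kernelForm (∑ k, ((X : ℝ[X]) ^ d k) • (S k).map C) r ?_ ?_
  · rw [pencil_map_eval] at h
    exact h
  · rw [pencil_map_eval]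
    unfold Matrix.IsSymm
    rw [Matrix.transpose_sum]
    exact Finset.sum_congr rfl fun k _ => by rw [Matrix.transpose_smul, (hS k).eq]
  · intro v hv hv0
    rw [pencil_map_eval] at hv
    rw [pencil_map_derivative_eval, form_derivative_eq_eval]
    exact hdef v hv hv0

/-- **Simple-root form.**  Under the same hypothesis with a ONE-dimensional kernel (`rank F(r) + 1 = card ι`), `r` is a
SIMPLE root of `det F`. [folklore] -/
theorem rootMultiplicity_det_pencil_eq_one (d : κ → ℕ) (S : κ → Matrix ι ι ℝ) (hS : ∀ k, (S k).IsSymm) (r : ℝ)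
    (hrank : (∑ k, r ^ d k • S k).rank + 1 = Fintype.card ι)
    (hdef : ∀ v : ι → ℝ, (∑ k, r ^ d k • S k) *ᵥ v = 0 → v ≠ 0 →
      (derivative (∑ k, C (v ⬝ᵥ (S k *ᵥ v)) * (X : ℝ[X]) ^ d k)).eval r ≠ 0) :
    (Matrix.det (∑ k, ((X : ℝ[X]) ^ d k) • (S k).map C)).rootMultiplicity r = 1 := by
  rw [(rootMultiplicity_det_pencil_eq_corank d S hS r hdef).2]
  omega

end Pencil

end Multiplicity

end Summit.ValiantsHypothesis.ValiantsHypothesis.Theorems.LacunarySymmetroidMatrixDescartes
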